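import Literature.NumberTheory.Sieve.DyadicPartitionOfUnity
import HarnessLib

/-!
# Matomäki–Merikoski §7, main term of `Σ̃_{S,S}`: summing the boxes turns `f_{M₁,M₂}` into the two brackets

Sibling of the `SiegelZeroPrimePairsMainTerm*` files.  Everything here is PROVED (theorems only; pure
algebra of finite sums).  With `F = dyadicBump`, the smooth weight of §7 (arXiv:2112.11412, p. 20) is

  `f_{M₁,M₂}(x₁,x₂,y₁,y₂) = g(x₁y₁) F(x₁) F(x₂) 𝔥(y₁) 𝔥(y₂) log(y₁N₁) log(y₂N₂)/log²X`,
  `N₁ = X/M₁`, `N₂ = X_+/M₂` (`X_+ = X + h`),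

with `g` supported in `[1,2]` and `𝔥 ≡ 1` on `[1/20, 20]`.  The main term of Proposition 2.3 for the box
`(M₁, M₂) = (2^{i₁}, 2^{i₂})` evaluates `f_{M₁,M₂}` at `(m₁/M₁, m₂/M₂, y/(m₁N₁), (y+h)/(m₂N₂))`; there
`x₁y₁ = y/X`, `y₁N₁ = y/m₁`, `y₂N₂ = (y+h)/m₂`, and `𝔥(y₁) = 𝔥(y₂) = 1` whenever `g(y/X)F(m₁/M₁)F(m₂/M₂) ≠ 0`.
Hence, pointwise in `y`, summing over the boxes `−2 ≤ i₁ ≤ b₁`, `−2 ≤ i₂ ≤ b₂` and over `m₁ ≤ L₁`, `m₂ ≤ L₂`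
(second display of p. 20 → last display of p. 20):

  `∑_{i₁,i₂} ∑_{m₁,m₂} c₁(m₁)c₂(m₂)/(m₁m₂) · f_{M₁,M₂}(…) = g(y/X)/log²X · B₁(y) · B₂(y)`,
  `B₁(y) = ∑_{m₁ ≤ L₁} c₁(m₁) log(y/m₁) W₁(m₁)/m₁`, `W₁(m) = ∑_{−2 ≤ i ≤ b₁} F(m/2^i)` (and likewise `B₂`)

(`MatomakiMerikoski.boxSum_pointwise_eq`), for arbitrary coefficient sequences `c₁, c₂` (in §7:
`cⱼ(m) = χ(m)·𝟙_{(m, P(z)) = 1}`).  Integrating in `y` and using `…MainTermDyadic` / `…MainTermIntegral` /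
`…MainTermProducts` gives the displayed evaluation of `Σ̃_{S,S}`.

## References

* K. Matomäki, J. Merikoski, IMRN 2023:23, 20337–20384 (arXiv:2112.11412), §7, p. 20 (definition of
  `f_{M₁,M₂}`, the decomposition into `Σ_{S,S}, …`) and the last display of p. 20.
  [cite: MatomakiMerikoski2023, §7 (main term of Σ_{S,S})]
-/

noncomputable section

open Finset

namespace Literature.Barriers.Parity.MatomakiMerikoski

open Literature.NumberTheory.Sieve

/-- The §7 weight `f_{M₁,M₂}` for the box `(M₁, M₂) = (2^{i₁}, 2^{i₂})`, `N₁ = X/M₁`, `N₂ = (X+h)/M₂`: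
`f(x₁,x₂,y₁,y₂) = g(x₁y₁) F(x₁) F(x₂) 𝔥(y₁) 𝔥(y₂) log(y₁N₁) log(y₂N₂)/log²X`.
[cite: MatomakiMerikoski2023, §7 (p. 20)] -/
def boxWeight (g 𝔥 : ℝ → ℝ) (X h : ℝ) (i₁ i₂ : ℤ) (x₁ x₂ y₁ y₂ : ℝ) : ℝ :=
  g (x₁ * y₁) * dyadicBump x₁ * dyadicBump x₂ * 𝔥 y₁ * 𝔥 y₂ *
    (Real.log (y₁ * (X / (2 : ℝ) ^ i₁)) * Real.log (y₂ * ((X + h) / (2 : ℝ) ^ i₂))) / Real.log X ^ 2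

/-- Unfolding lemma for `boxWeight`. [folklore] -/
theorem boxWeight_def (g 𝔥 : ℝ → ℝ) (X h : ℝ) (i₁ i₂ : ℤ) (x₁ x₂ y₁ y₂ : ℝ) :
    boxWeight g 𝔥 X h i₁ i₂ x₁ x₂ y₁ y₂ = g (x₁ * y₁) * dyadicBump x₁ * dyadicBump x₂ * 𝔥 y₁ * 𝔥 y₂ *
      (Real.log (y₁ * (X / (2 : ℝ) ^ i₁)) * Real.log (y₂ * ((X + h) / (2 : ℝ) ^ i₂))) / Real.log X ^ 2 :=
  rfl

/-- **One term.**  For `X > 0`, `h ≥ 0`, `y`, integers `m₁, m₂ ≥ 1`, with `M₁ = 2^{i₁}`, `N₁ = X/M₁`,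
`M₂ = 2^{i₂}`, `N₂ = (X+h)/M₂`: if `g` vanishes outside `[1,2]` and `𝔥 ≡ 1` on `[1/20, 20]`, then
`f_{M₁,M₂}(m₁/M₁, m₂/M₂, y/(m₁N₁), (y+h)/(m₂N₂)) = g(y/X) F(m₁/M₁) F(m₂/M₂) log(y/m₁) log((y+h)/m₂)/log²X`.
[cite: MatomakiMerikoski2023, §7 (p. 20, last display)] -/
theorem boxWeight_apply_eq {g 𝔥 : ℝ → ℝ} (hg : ∀ t, g t ≠ 0 → 1 ≤ t ∧ t ≤ 2)
    (h𝔥 : ∀ t, 1 / 20 ≤ t → t ≤ 20 → 𝔥 t = 1) {X h : ℝ} (hX : 0 < X) (hh : 0 ≤ h) (i₁ i₂ : ℤ) (y : ℝ)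
    {m₁ m₂ : ℕ} (hm₁ : 1 ≤ m₁) (hm₂ : 1 ≤ m₂) :
    boxWeight g 𝔥 X h i₁ i₂ ((m₁ : ℝ) / (2 : ℝ) ^ i₁) ((m₂ : ℝ) / (2 : ℝ) ^ i₂)
        (y / ((m₁ : ℝ) * (X / (2 : ℝ) ^ i₁))) ((y + h) / ((m₂ : ℝ) * ((X + h) / (2 : ℝ) ^ i₂))) =
      g (y / X) * dyadicBump ((m₁ : ℝ) / (2 : ℝ) ^ i₁) * dyadicBump ((m₂ : ℝ) / (2 : ℝ) ^ i₂) *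
        (Real.log (y / m₁) * Real.log ((y + h) / m₂)) / Real.log X ^ 2 := by
  have hM₁ : (0 : ℝ) < (2 : ℝ) ^ i₁ := zpow_pos two_pos _
  have hM₂ : (0 : ℝ) < (2 : ℝ) ^ i₂ := zpow_pos two_pos _
  have hm₁0 : (0 : ℝ) < m₁ := by exact_mod_cast hm₁
  have hm₂0 : (0 : ℝ) < m₂ := by exact_mod_cast hm₂
  have hXh : 0 < X + h := by linarith
  rw [boxWeight_def]
  -- the arguments simplify
  have e1 : (m₁ : ℝ) / (2 : ℝ) ^ i₁ * (y / ((m₁ : ℝ) * (X / (2 : ℝ) ^ i₁))) = y / X := by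
    field_simp
  have e2 : y / ((m₁ : ℝ) * (X / (2 : ℝ) ^ i₁)) * (X / (2 : ℝ) ^ i₁) = y / m₁ := by
    field_simp
  have e3 : (y + h) / ((m₂ : ℝ) * ((X + h) / (2 : ℝ) ^ i₂)) * ((X + h) / (2 : ℝ) ^ i₂) = (y + h) / m₂ := by
    field_simp
  rw [e1, e2, e3]
  -- either a factor `g(y/X) F(m₁/M₁) F(m₂/M₂)` vanishes, or both `𝔥`'s are `1`
  by_cases h0 : g (y / X) * dyadicBump ((m₁ : ℝ) / (2 : ℝ) ^ i₁) * dyadicBump ((m₂ : ℝ) / (2 : ℝ) ^ i₂) = 0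
  · have eL : g (y / X) * dyadicBump ((m₁ : ℝ) / (2 : ℝ) ^ i₁) * dyadicBump ((m₂ : ℝ) / (2 : ℝ) ^ i₂) *
        𝔥 (y / ((m₁ : ℝ) * (X / (2 : ℝ) ^ i₁))) * 𝔥 ((y + h) / ((m₂ : ℝ) * ((X + h) / (2 : ℝ) ^ i₂))) *
        (Real.log (y / m₁) * Real.log ((y + h) / m₂)) / Real.log X ^ 2 =
        (g (y / X) * dyadicBump ((m₁ : ℝ) / (2 : ℝ) ^ i₁) * dyadicBump ((m₂ : ℝ) / (2 : ℝ) ^ i₂)) *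
          (𝔥 (y / ((m₁ : ℝ) * (X / (2 : ℝ) ^ i₁))) * 𝔥 ((y + h) / ((m₂ : ℝ) * ((X + h) / (2 : ℝ) ^ i₂))) *
          (Real.log (y / m₁) * Real.log ((y + h) / m₂)) / Real.log X ^ 2) := by ring
    have eR : g (y / X) * dyadicBump ((m₁ : ℝ) / (2 : ℝ) ^ i₁) * dyadicBump ((m₂ : ℝ) / (2 : ℝ) ^ i₂) *
        (Real.log (y / m₁) * Real.log ((y + h) / m₂)) / Real.log X ^ 2 =
        (g (y / X) * dyadicBump ((m₁ : ℝ) / (2 : ℝ) ^ i₁) * dyadicBump ((m₂ : ℝ) / (2 : ℝ) ^ i₂)) *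
          ((Real.log (y / m₁) * Real.log ((y + h) / m₂)) / Real.log X ^ 2) := by ring
    rw [eL, eR, h0, zero_mul, zero_mul]
  · -- all three factors are non-zero: extract the ranges
    have hg0 : g (y / X) ≠ 0 := fun h' => h0 (by rw [h']; ring)
    have hF1 : dyadicBump ((m₁ : ℝ) / (2 : ℝ) ^ i₁) ≠ 0 := fun h' => h0 (by rw [h']; ring)
    have hF2 : dyadicBump ((m₂ : ℝ) / (2 : ℝ) ^ i₂) ≠ 0 := fun h' => h0 (by rw [h']; ring)
    obtain ⟨hy1, hy2⟩ := hg (y / X) hg0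
    have hr1 := support_dyadicBump_subset (Function.mem_support.mpr hF1)
    have hr2 := support_dyadicBump_subset (Function.mem_support.mpr hF2)
    rw [Set.mem_Ioo] at hr1 hr2
    -- `y₁ = (y/X) · (M₁/m₁) ∈ [1/4, 2]`
    have hy1' : y / ((m₁ : ℝ) * (X / (2 : ℝ) ^ i₁)) = (y / X) / ((m₁ : ℝ) / (2 : ℝ) ^ i₁) := by
      field_simp
    have hy2' : (y + h) / ((m₂ : ℝ) * ((X + h) / (2 : ℝ) ^ i₂)) =
        ((y + h) / (X + h)) / ((m₂ : ℝ) / (2 : ℝ) ^ i₂) := by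
      field_simp
    have hq1 : 0 < (m₁ : ℝ) / (2 : ℝ) ^ i₁ := by positivity
    have hq2 : 0 < (m₂ : ℝ) / (2 : ℝ) ^ i₂ := by positivity
    have hyX : X ≤ y := by rwa [le_div_iff₀ hX, one_mul] at hy1
    have hyX2 : y ≤ 2 * X := by rwa [div_le_iff₀ hX] at hy2
    have hz1 : 1 ≤ (y + h) / (X + h) := by rw [le_div_iff₀ hXh]; linarith
    have hz2 : (y + h) / (X + h) ≤ 2 := by rw [div_le_iff₀ hXh]; linarith
    have h𝔥1 : 𝔥 (y / ((m₁ : ℝ) * (X / (2 : ℝ) ^ i₁))) = 1 := by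
      rw [hy1']
      refine h𝔥 _ ?_ ?_
      · rw [le_div_iff₀ hq1]; nlinarith
      · rw [div_le_iff₀ hq1]; nlinarith
    have h𝔥2 : 𝔥 ((y + h) / ((m₂ : ℝ) * ((X + h) / (2 : ℝ) ^ i₂))) = 1 := by
      rw [hy2']
      refine h𝔥 _ ?_ ?_
      · rw [le_div_iff₀ hq2]; nlinarith
      · rw [div_le_iff₀ hq2]; nlinarith
    rw [h𝔥1, h𝔥2, mul_one, mul_one]

/-- **Summing the boxes** (pointwise in `y`): with `W_j(m) = ∑_{−2 ≤ i ≤ b_j} F(m/2^i)`,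
`∑_{i₁,i₂} ∑_{m₁ ≤ L₁, m₂ ≤ L₂} c₁(m₁)c₂(m₂)/(m₁m₂) f_{M₁,M₂}(m₁/M₁, m₂/M₂, y/(m₁N₁), (y+h)/(m₂N₂))`
`= g(y/X)/log²X · (∑_{m₁ ≤ L₁} c₁(m₁) log(y/m₁) W₁(m₁)/m₁) · (∑_{m₂ ≤ L₂} c₂(m₂) log((y+h)/m₂) W₂(m₂)/m₂)`.
[cite: MatomakiMerikoski2023, §7 (p. 20, last display)] -/
theorem boxSum_pointwise_eq {g 𝔥 : ℝ → ℝ} (hg : ∀ t, g t ≠ 0 → 1 ≤ t ∧ t ≤ 2)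
    (h𝔥 : ∀ t, 1 / 20 ≤ t → t ≤ 20 → 𝔥 t = 1) {X h : ℝ} (hX : 0 < X) (hh : 0 ≤ h) (b₁ b₂ : ℕ)
    (L₁ L₂ : ℕ) (c₁ c₂ : ℕ → ℝ) (y : ℝ) :
    ∑ i₁ ∈ Finset.Icc (-2 : ℤ) b₁, ∑ i₂ ∈ Finset.Icc (-2 : ℤ) b₂, ∑ m₁ ∈ Icc 1 L₁, ∑ m₂ ∈ Icc 1 L₂,
        c₁ m₁ * c₂ m₂ / ((m₁ : ℝ) * m₂) *
          boxWeight g 𝔥 X h i₁ i₂ ((m₁ : ℝ) / (2 : ℝ) ^ i₁) ((m₂ : ℝ) / (2 : ℝ) ^ i₂)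
            (y / ((m₁ : ℝ) * (X / (2 : ℝ) ^ i₁))) ((y + h) / ((m₂ : ℝ) * ((X + h) / (2 : ℝ) ^ i₂))) =
      g (y / X) / Real.log X ^ 2 *
        ((∑ m₁ ∈ Icc 1 L₁, c₁ m₁ * Real.log (y / m₁) / m₁ *
            ∑ i₁ ∈ Finset.Icc (-2 : ℤ) b₁, dyadicBump ((m₁ : ℝ) / (2 : ℝ) ^ i₁)) *
          ∑ m₂ ∈ Icc 1 L₂, c₂ m₂ * Real.log ((y + h) / m₂) / m₂ *
            ∑ i₂ ∈ Finset.Icc (-2 : ℤ) b₂, dyadicBump ((m₂ : ℝ) / (2 : ℝ) ^ i₂)) := by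
  -- termwise evaluation
  have hterm : ∀ i₁ i₂ : ℤ, ∀ m₁ ∈ Icc 1 L₁, ∀ m₂ ∈ Icc 1 L₂,
      c₁ m₁ * c₂ m₂ / ((m₁ : ℝ) * m₂) *
          boxWeight g 𝔥 X h i₁ i₂ ((m₁ : ℝ) / (2 : ℝ) ^ i₁) ((m₂ : ℝ) / (2 : ℝ) ^ i₂)
            (y / ((m₁ : ℝ) * (X / (2 : ℝ) ^ i₁))) ((y + h) / ((m₂ : ℝ) * ((X + h) / (2 : ℝ) ^ i₂))) =
        g (y / X) / Real.log X ^ 2 *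
          ((c₁ m₁ * Real.log (y / m₁) / m₁ * dyadicBump ((m₁ : ℝ) / (2 : ℝ) ^ i₁)) *
            (c₂ m₂ * Real.log ((y + h) / m₂) / m₂ * dyadicBump ((m₂ : ℝ) / (2 : ℝ) ^ i₂))) := by
    intro i₁ i₂ m₁ hm₁ m₂ hm₂
    rw [mem_Icc] at hm₁ hm₂
    rw [boxWeight_apply_eq hg h𝔥 hX hh i₁ i₂ y hm₁.1 hm₂.1]
    have hm₁0 : (m₁ : ℝ) ≠ 0 := Nat.cast_ne_zero.mpr (by omega)
    have hm₂0 : (m₂ : ℝ) ≠ 0 := Nat.cast_ne_zero.mpr (by omega)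
    field_simp
  -- names for the two one-variable summands
  set α : ℕ → ℤ → ℝ := fun m₁ i₁ => c₁ m₁ * Real.log (y / m₁) / m₁ * dyadicBump ((m₁ : ℝ) / (2 : ℝ) ^ i₁)
    with hα
  set β : ℕ → ℤ → ℝ := fun m₂ i₂ =>
    c₂ m₂ * Real.log ((y + h) / m₂) / m₂ * dyadicBump ((m₂ : ℝ) / (2 : ℝ) ^ i₂) with hβ
  set K : ℝ := g (y / X) / Real.log X ^ 2 with hK
  -- rewrite every term
  have step1 : ∑ i₁ ∈ Finset.Icc (-2 : ℤ) b₁, ∑ i₂ ∈ Finset.Icc (-2 : ℤ) b₂, ∑ m₁ ∈ Icc 1 L₁, ∑ m₂ ∈ Icc 1 L₂,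
        c₁ m₁ * c₂ m₂ / ((m₁ : ℝ) * m₂) *
          boxWeight g 𝔥 X h i₁ i₂ ((m₁ : ℝ) / (2 : ℝ) ^ i₁) ((m₂ : ℝ) / (2 : ℝ) ^ i₂)
            (y / ((m₁ : ℝ) * (X / (2 : ℝ) ^ i₁))) ((y + h) / ((m₂ : ℝ) * ((X + h) / (2 : ℝ) ^ i₂))) =
      ∑ i₁ ∈ Finset.Icc (-2 : ℤ) b₁, ∑ i₂ ∈ Finset.Icc (-2 : ℤ) b₂,
        K * ((∑ m₁ ∈ Icc 1 L₁, α m₁ i₁) * ∑ m₂ ∈ Icc 1 L₂, β m₂ i₂) := by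
    refine sum_congr rfl fun i₁ _ => sum_congr rfl fun i₂ _ => ?_
    rw [sum_mul_sum, mul_sum]
    refine sum_congr rfl fun m₁ hm₁ => ?_
    rw [mul_sum]
    refine sum_congr rfl fun m₂ hm₂ => ?_
    rw [hterm i₁ i₂ m₁ hm₁ m₂ hm₂]
  rw [step1]
  -- factor: `∑_{i₁,i₂} K S₁(i₁) S₂(i₂) = K (∑ S₁)(∑ S₂)` and swap `∑_{i} ∑_{m} = ∑_{m} ∑_{i}`
  have step2 : ∑ i₁ ∈ Finset.Icc (-2 : ℤ) b₁, ∑ i₂ ∈ Finset.Icc (-2 : ℤ) b₂,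
        K * ((∑ m₁ ∈ Icc 1 L₁, α m₁ i₁) * ∑ m₂ ∈ Icc 1 L₂, β m₂ i₂) =
      K * ((∑ i₁ ∈ Finset.Icc (-2 : ℤ) b₁, ∑ m₁ ∈ Icc 1 L₁, α m₁ i₁) *
        ∑ i₂ ∈ Finset.Icc (-2 : ℤ) b₂, ∑ m₂ ∈ Icc 1 L₂, β m₂ i₂) := by
    rw [sum_mul_sum, mul_sum]
    refine sum_congr rfl fun i₁ _ => ?_
    rw [mul_sum]
  rw [step2, sum_comm (s := Finset.Icc (-2 : ℤ) b₁), sum_comm (s := Finset.Icc (-2 : ℤ) b₂)]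
  congr 1
  congr 1
  · refine sum_congr rfl fun m₁ _ => ?_
    rw [mul_sum]
  · refine sum_congr rfl fun m₂ _ => ?_
    rw [mul_sum]

end Literature.Barriers.Parity.MatomakiMerikoski
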